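import Summits.CriticalPhenomena.CardyFormulaZ2.Theorems.CardyWhiteToColouredNoiseDiscretisationCountable
import Summits.CriticalPhenomena.CardyFormulaZ2.Theorems.CardyWhiteToColouredNoiseDiscretisationWhiteNoise
import Summits.CriticalPhenomena.CardyFormulaZ2.Theorems.CardyWhiteToColouredNoiseDiscretisationEnvelope

/-!
# No atom: almost every smoothed white noise is robust (stub `ae_robust` of `NoiseDiscretisation`)

Helper file for item `NoiseDiscretisation` (stmt-CriticalPhenomena-4598) of route
`CardyWhiteToColoured` (`CardyFormulaZ2`). For a white noise `μ`, a Gaussian bump family `k`,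
`ℓ > 0` and a conformal rectangle `R`, `μ`-almost every configuration `ω` has a *robust* smoothed
field `x ↦ ω (k ℓ x)`: either `R̄` is crossed at level `0`, or it is not crossed at some negative
level (`ae_robust`). Proof (Cameron–Martin flavour, through independence): with a normalised test
function `ψ` and `Z = ω(ψ) ~ N(0,1)`, the smoothed field splits as `Z φ + G` with
`φ = cov(field, Z) > 0` continuous, bounded below on the compact `closure Ω`, and the process `G`
independent of `Z` (jointly Gaussian, uncorrelated: Mathlib's
`IsGaussianProcess.indepFun_of_covariance_eq_zero`). For a fixed continuous `G`, robustness of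
`t φ + G` fails for at most one `t` (monotonicity in `t`). Robustness of a continuous field is a
countable statement on its values at the medial points of the lattices `(n+1)⁻¹ℤ²`
(`robust_iff_countable`), hence a measurable event of `(Z, (G at those points))`, whose law is a
product; Fubini and the absence of atoms of `N(0,1)` conclude.

References: V. Beffara, D. Gayet, Publ. IHÉS 126 (2017), §1 and App. A (non-degeneracy); R. H.
Cameron, W. T. Martin, Ann. of Math. 45 (1944) (shifts of Gaussian measures).
-/

noncomputable section

namespace Summit.CriticalPhenomena.CardyFormulaZ2.Theorems

namespace WhiteToColoured

open Set Metric MeasureTheory Filter Topology ProbabilityTheory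
open Literature.Probability.LatticeModels Literature.Probability.Percolation
open Literature.Probability.RandomPlanarGeometry
open Literature.MathematicalPhysics.QuantumLattice

/-- `PosCross[R, F, c]`: some path in `closure R.carrier` from `arc 0` to `arc 2` has `F > c`. -/
local notation3 "PosCross[" R ", " F ", " c "]" =>
  ∃ x ∈ MarkedDomain.arc R (0 : Fin 4), ∃ y ∈ MarkedDomain.arc R (2 : Fin 4), ∃ γ : Path x y,
    ∀ t, γ t ∈ closure (JordanDomain.carrier (MarkedDomain.toJordanDomain R)) ∧
      (c : ℝ) < (F : ℂ → ℝ) (γ t)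

/-- `Robust[R, F]`: a positive crossing exists, or no crossing survives some negative margin. -/
local notation3 "Robust[" R ", " F "]" =>
  (PosCross[R, F, 0] ∨ ∃ c : ℝ, 0 < c ∧ ¬ PosCross[R, F, -c])

/-- `CfgQ[R, F, c]`: the countable form of the crossing event (see `posCross_iff_countable`). -/
local notation3 "CfgQ[" R ", " F ", " c "]" =>
  ∃ c' : ℚ, (c : ℝ) < c' ∧ ∃ N : ℕ, ∀ n : ℕ, N ≤ n →
    {e : Sym2 (Site 2) | e ∈ (zdGraph 2).edgeSet ∧
        (c' : ℝ) < (F : ℂ → ℝ) (medialPoint ((n : ℝ) + 1)⁻¹ e)} ∈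
      discreteCrossing (JordanDomain.carrier (MarkedDomain.toJordanDomain R)) ((n : ℝ) + 1)⁻¹
        (MarkedDomain.arc R (0 : Fin 4)) (MarkedDomain.arc R (2 : Fin 4))

/-! ### Robustness fails for at most one shift -/

/-- **At most one shift is bad.** If `φ ≥ φ₀ > 0` on `closure Ω`, then among the fields
`t φ + G`, `t ∈ ℝ`, at most one is not robust. -/
theorem subsingleton_not_robust_shift (R : ConformalRectangle) {G φ : ℂ → ℝ} {φ₀ : ℝ} (hφ₀ : 0 < φ₀)
    (hφ : ∀ z ∈ closure R.carrier, φ₀ ≤ φ z) :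
    Set.Subsingleton {t : ℝ | ¬ Robust[R, fun x => t * φ x + G x]} := by
  -- a bad smaller shift forces a positive crossing for any larger shift
  have key : ∀ t t' : ℝ, t < t' → ¬ Robust[R, fun x => t * φ x + G x] →
      PosCross[R, fun x => t' * φ x + G x, 0] := by
    intro t t' htt' ht
    push Not at ht
    obtain ⟨-, hall⟩ := ht
    obtain ⟨x, hx, y, hy, γ, hγ⟩ := hall ((t' - t) * φ₀) (by nlinarith)
    refine ⟨x, hx, y, hy, γ, fun s => ⟨(hγ s).1, ?_⟩⟩
    have h1 := (hγ s).2
    have h2 := hφ _ (hγ s).1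
    nlinarith
  intro t ht t' ht'
  by_contra hne
  rcases lt_or_gt_of_ne hne with hlt | hlt
  · exact ht' (Or.inl (key t t' hlt ht))
  · exact ht (Or.inl (key t' t hlt ht'))

/-! ### The test direction `ψ` and the covariance profile `φ` -/

section

variable {μ : Measure (FieldConfig ℂ)} {k : ℝ → ℂ → SchwartzMap ℂ ℝ} {ℓ : ℝ}

/-- **A normalised positive test function** built from the bump family: `ψ = k 1 0 / ‖k 1 0‖₂`,
with `ψ > 0` and `∫ ψ² = 1`. -/
theorem exists_normalised_bump (hk : IsGaussianBumpFamily k) :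
    ∃ ψ : SchwartzMap ℂ ℝ, (∀ z, 0 < ψ z) ∧ ∫ z, ψ z ^ 2 = 1 := by
  set ψ₀ := k 1 0 with hψ₀
  have hpos : ∀ z, 0 < ψ₀ z := fun z => hk.apply_pos one_pos 0 z
  have hint : Integrable fun z => ψ₀ z ^ 2 := by
    have := integrable_mul_schwartz ψ₀ ψ₀
    exact this.congr (Eventually.of_forall fun z => by simp [sq])
  have hn : 0 < ∫ z, ψ₀ z ^ 2 := by
    rw [integral_pos_iff_support_of_nonneg (fun z => sq_nonneg _) hint]
    have : Function.support (fun z => ψ₀ z ^ 2) = univ := by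
      ext z
      simp only [Function.mem_support, mem_univ, iff_true]
      exact (pow_pos (hpos z) 2).ne'
    rw [this]
    exact (measure_ball_pos volume (0 : ℂ) one_pos).trans_le (measure_mono (subset_univ _))
  set n := Real.sqrt (∫ z, ψ₀ z ^ 2) with hn'
  have hnpos : 0 < n := Real.sqrt_pos.2 hn
  refine ⟨n⁻¹ • ψ₀, fun z => ?_, ?_⟩
  · rw [smul_apply, smul_eq_mul]; exact mul_pos (inv_pos.2 hnpos) (hpos z)
  · simp only [smul_apply, smul_eq_mul, mul_pow]
    rw [integral_const_mul, inv_pow, Real.sq_sqrt hn.le, inv_mul_cancel₀ hn.ne']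

/-- **The covariance profile** `φ z = ∫ k ℓ z · ψ` is continuous and positive when `ψ > 0`. -/
theorem continuous_pos_profile (hk : IsGaussianBumpFamily k) (hℓ : 0 < ℓ) {ψ : SchwartzMap ℂ ℝ}
    (hψ : ∀ z, 0 < ψ z) :
    Continuous (fun z => ∫ y, k ℓ z y * ψ y) ∧ ∀ z, 0 < ∫ y, k ℓ z y * ψ y := by
  have hψint : Integrable (fun y => |ψ y|) := (ψ.integrable).abs
  constructor
  · refine continuous_of_dominated (bound := fun y => |ψ y|) (fun z => ?_) (fun z => ?_) hψint ?_
    · exact (integrable_mul_schwartz (k ℓ z) ψ).aestronglyMeasurable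
    · refine Eventually.of_forall fun y => ?_
      rw [Real.norm_eq_abs, abs_mul]
      refine mul_le_of_le_one_left (abs_nonneg _) ?_
      rw [hk.apply_eq_gaussWeight hℓ, abs_of_pos (gaussWeight_pos _ _)]
      exact gaussWeight_le_one ℓ _
    · refine Eventually.of_forall fun y => ?_
      have : (fun z => k ℓ z y * ψ y) = fun z => gaussWeight ℓ (y - z) * ψ y := by
        funext z; rw [hk.apply_eq_gaussWeight hℓ]
      rw [this]
      refine Continuous.mul ?_ continuous_const
      unfold gaussWeight
      fun_prop
  · intro z
    have hint : Integrable fun y => k ℓ z y * ψ y := integrable_mul_schwartz (k ℓ z) ψ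
    have hposf : ∀ y, 0 < k ℓ z y * ψ y := fun y => mul_pos (hk.apply_pos hℓ z y) (hψ y)
    rw [integral_pos_iff_support_of_nonneg (fun y => (hposf y).le) hint]
    have : Function.support (fun y => k ℓ z y * ψ y) = univ := by
      ext y
      simp only [Function.mem_support, mem_univ, iff_true]
      exact (hposf y).ne'
    rw [this]
    exact (measure_ball_pos volume (0 : ℂ) one_pos).trans_le (measure_mono (subset_univ _))

/-! ### The Gaussian decomposition `field = Z φ + G` and the independence -/

/-- **The no-atom theorem.** Almost every smoothed white noise is robust. -/
theorem ae_robust (hμ : IsWhiteNoise μ) (hk : IsGaussianBumpFamily k) (hℓ : 0 < ℓ)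
    (R : ConformalRectangle) : ∀ᵐ ω ∂μ, Robust[R, fun x => ω (k ℓ x)] := by
  classical
  haveI := wn_isProbabilityMeasure hμ
  set Ω := R.carrier with hΩdef
  -- the test direction and the covariance profile
  obtain ⟨ψ, hψpos, hψnorm⟩ := exists_normalised_bump hk
  set φ : ℂ → ℝ := fun z => ∫ y, k ℓ z y * ψ y with hφdef
  obtain ⟨hφc, hφpos⟩ := continuous_pos_profile hk hℓ hψpos
  -- lower bound of `φ` on the compact `closure Ω`
  have hK : IsCompact (closure Ω) := R.isBounded.isCompact_closure
  have hKne : (closure Ω).Nonempty := R.nonempty.mono subset_closure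
  obtain ⟨z₀, hz₀, hmin⟩ := hK.exists_isMinOn hKne hφc.continuousOn
  set φ₀ := φ z₀ with hφ₀
  have hφ₀pos : 0 < φ₀ := hφpos z₀
  have hφge : ∀ z ∈ closure Ω, φ₀ ≤ φ z := fun z hz => hmin hz
  -- the countable family of sampling points and the orthogonalised test functions
  set pt : ℕ × Sym2 (Site 2) → ℂ := fun i => medialPoint ((i.1 : ℝ) + 1)⁻¹ i.2 with hpt
  set gS : ℕ × Sym2 (Site 2) → SchwartzMap ℂ ℝ := fun i => k ℓ (pt i) - φ (pt i) • ψ with hgS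
  -- the random variables
  set Z : FieldConfig ℂ → ℝ := fun ω => ω ψ with hZ
  set Y : FieldConfig ℂ → (ℕ × Sym2 (Site 2) → ℝ) := fun ω i => ω (gS i) with hY
  have hZm : Measurable Z := measurable_eval ψ
  have hYm : Measurable Y := measurable_pi_lambda _ fun i => measurable_eval (gS i)
  have hfield : ∀ (ω : FieldConfig ℂ) i, ω (k ℓ (pt i)) = Z ω * φ (pt i) + Y ω i := by
    intro ω i
    simp only [hY, hgS, hZ, map_sub, map_smul, smul_eq_mul]
    ring
  -- independence of `Z` and `Y`
  have hindep : IndepFun Z Y μ := by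
    have hproc : IsGaussianProcess (Sum.elim (fun _ : Unit => Z) (fun i ω => Y ω i)) μ := by
      constructor
      intro I
      set fS : I → SchwartzMap ℂ ℝ := fun i => Sum.elim (fun _ : Unit => ψ) gS i.1 with hfS
      have hG := hasGaussianLaw_pi hμ.1 fS
      have heq : (fun (ω : FieldConfig ℂ) (i : I) => ω (fS i)) =
          fun ω => I.restrict (Sum.elim (fun _ : Unit => Z) (fun i ω => Y ω i) · ω) := by
        funext ω i
        rcases i with ⟨i, hi⟩
        cases i <;> rfl
      rwa [heq] at hG
    have h := hproc.indepFun_of_covariance_eq_zero (fun _ => hZm.aemeasurable)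
      (fun i => (measurable_eval (gS i)).aemeasurable) fun _ i => ?_
    · exact h.comp (φ := fun f : Unit → ℝ => f ()) (ψ := id) (measurable_pi_apply ()) measurable_id
    · show cov[fun ω : FieldConfig ℂ => ω ψ, fun ω : FieldConfig ℂ => ω (gS i); μ] = 0
      rw [wn_covariance_eval hμ]
      have h1 : (fun z => ψ z * gS i z) = fun z => k ℓ (pt i) z * ψ z - φ (pt i) * ψ z ^ 2 := by
        funext z
        simp only [hgS, sub_apply, smul_apply, smul_eq_mul]
        ring
      rw [h1, integral_sub (integrable_mul_schwartz _ _) ((integrable_mul_schwartz ψ ψ).congr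
        (Eventually.of_forall fun z => by simp [sq]) |>.const_mul _), integral_const_mul, hψnorm]
      simp [hφdef]
  have hlaw : μ.map (fun ω => (Z ω, Y ω)) = (μ.map Z).prod (μ.map Y) :=
    (indepFun_iff_map_prod_eq_prod_map_map hZm.aemeasurable hYm.aemeasurable).1 hindep
  have hZlaw : μ.map Z = gaussianReal 0 1 := by
    rw [hZ, wn_map_eval_eq_gaussianReal hμ ψ, hψnorm]; simp
  haveI : NullSingletonClass (μ.map Z) := by
    rw [hZlaw]; exact nullSingletonClass_gaussianReal one_ne_zero
  -- the measurable countable form of (non-)robustness, on `ℝ × (ι → ℝ)`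
  set cfg : ℕ → ℚ → (ℝ × (ℕ × Sym2 (Site 2) → ℝ)) → BondConfig (Site 2) := fun n q p =>
    {e : Sym2 (Site 2) | e ∈ (zdGraph 2).edgeSet ∧ (q : ℝ) < p.1 * φ (pt (n, e)) + p.2 (n, e)} with hcfg
  have hcfgm : ∀ n q, Measurable (cfg n q) := by
    intro n q
    refine measurable_set_iff.2 fun e => ?_
    refine measurable_to_prop ?_
    have : (fun p : ℝ × (ℕ × Sym2 (Site 2) → ℝ) => e ∈ cfg n q p) ⁻¹' {True} =
        {p | e ∈ (zdGraph 2).edgeSet ∧ (q : ℝ) < p.1 * φ (pt (n, e)) + p.2 (n, e)} := by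
      ext p; simp [hcfg]
    rw [this]
    have hf : Measurable fun p : ℝ × (ℕ × Sym2 (Site 2) → ℝ) => p.1 * φ (pt (n, e)) + p.2 (n, e) :=
      (measurable_fst.mul_const _).add ((measurable_pi_apply (n, e)).comp measurable_snd)
    exact (measurableSet_setOf.2 measurable_const).inter (measurableSet_lt measurable_const hf)
  -- `Q c p` : the countable crossing statement at level `c` read on `p`
  set Q : ℚ → Set (ℝ × (ℕ × Sym2 (Site 2) → ℝ)) := fun c =>
    ⋃ (c' : ℚ) (_ : c < c'), ⋃ N : ℕ, ⋂ (n : ℕ) (_ : N ≤ n),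
      cfg n c' ⁻¹' discreteCrossing Ω ((n : ℝ) + 1)⁻¹ (R.arc 0) (R.arc 2) with hQ
  have hQm : ∀ c, MeasurableSet (Q c) := fun c =>
    MeasurableSet.iUnion fun c' => MeasurableSet.iUnion fun _ => MeasurableSet.iUnion fun N =>
      MeasurableSet.iInter fun n => MeasurableSet.iInter fun _ =>
        (measurableSet_discreteCrossing _ _ _ _).preimage (hcfgm n c')
  set S : Set (ℝ × (ℕ × Sym2 (Site 2) → ℝ)) := (Q 0 ∪ ⋃ (c : ℚ) (_ : 0 < c), (Q (-c))ᶜ)ᶜ with hS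
  have hSm : MeasurableSet S :=
    ((hQm 0).union (MeasurableSet.iUnion fun c => MeasurableSet.iUnion fun _ => (hQm _).compl)).compl
  -- reading the countable statement of a continuous field with the right sample values
  have hread : ∀ (F : ℂ → ℝ) (p : ℝ × (ℕ × Sym2 (Site 2) → ℝ)),
      (∀ i, F (pt i) = p.1 * φ (pt i) + p.2 i) → ∀ c : ℚ, (CfgQ[R, F, (c : ℝ)] ↔ p ∈ Q c) := by
    intro F p hFp c
    have hcfgF : ∀ (n : ℕ) (c' : ℚ), {e : Sym2 (Site 2) | e ∈ (zdGraph 2).edgeSet ∧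
        (c' : ℝ) < F (medialPoint ((n : ℝ) + 1)⁻¹ e)} = cfg n c' p := by
      intro n c'
      ext e
      simp only [hcfg, mem_setOf_eq]
      rw [show medialPoint ((n : ℝ) + 1)⁻¹ e = pt (n, e) from rfl, hFp]
    simp only [hQ, mem_iUnion, mem_iInter, mem_preimage, exists_prop]
    constructor
    · rintro ⟨c', hc', N, hN⟩
      exact ⟨c', by exact_mod_cast hc', N, fun n hn => by rw [← hcfgF]; exact hN n hn⟩
    · rintro ⟨c', hc', N, hN⟩
      exact ⟨c', by exact_mod_cast hc', N, fun n hn => by rw [hcfgF]; exact hN n hn⟩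
  have hreadR : ∀ (F : ℂ → ℝ) (p : ℝ × (ℕ × Sym2 (Site 2) → ℝ)), Continuous F →
      (∀ i, F (pt i) = p.1 * φ (pt i) + p.2 i) → (¬ Robust[R, F] ↔ p ∈ S) := by
    intro F p hF hFp
    rw [robust_iff_countable R hF, hS, mem_compl_iff, not_iff_not]
    simp only [mem_union, mem_iUnion, mem_compl_iff, exists_prop]
    refine or_congr ?_ ⟨?_, ?_⟩
    · have := hread F p hFp 0
      push_cast at this
      exact this
    · rintro ⟨c, hc, hn⟩
      refine ⟨c, hc, fun h => hn ?_⟩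
      have := hread F p hFp (-c)
      push_cast at this
      exact this.2 h
    · rintro ⟨c, hc, hn⟩
      refine ⟨c, hc, fun h => hn ?_⟩
      have := hread F p hFp (-c)
      push_cast at this
      exact this.1 h
  -- the bad event is the preimage of `S`
  have hbad : {ω : FieldConfig ℂ | ¬ Robust[R, fun x => ω (k ℓ x)]} ⊆ (fun ω => (Z ω, Y ω)) ⁻¹' S := by
    intro ω hω
    exact (hreadR (fun x => ω (k ℓ x)) (Z ω, Y ω) (continuous_field hk hℓ ω)
      (fun i => hfield ω i)).1 hω
  -- the fibres of `S` over `Y ω` are subsingletons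
  have hfib : ∀ ω : FieldConfig ℂ, ((fun t : ℝ => (t, Y ω)) ⁻¹' S).Subsingleton := by
    intro ω
    set G : ℂ → ℝ := fun x => ω (k ℓ x) - Z ω * φ x with hG
    have hGc : Continuous G := (continuous_field hk hℓ ω).sub (continuous_const.mul hφc)
    have hsub : (fun t : ℝ => (t, Y ω)) ⁻¹' S ⊆ {t : ℝ | ¬ Robust[R, fun x => t * φ x + G x]} := by
      intro t ht
      have hFt : Continuous fun x => t * φ x + G x := (continuous_const.mul hφc).add hGc
      refine (hreadR (fun x => t * φ x + G x) (t, Y ω) hFt (fun i => ?_)).2 ht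
      simp only [hG]
      have := hfield ω i
      linarith
    exact (subsingleton_not_robust_shift R hφ₀pos hφge).anti hsub
  -- Fubini
  rw [ae_iff]
  refine measure_mono_null hbad ?_
  rw [← Measure.map_apply (hZm.prodMk hYm) hSm, hlaw, Measure.prod_apply_symm hSm,
    lintegral_map (measurable_measure_prodMk_right hSm) hYm]
  simp_rw [fun ω => (hfib ω).measure_zero (μ.map Z)]
  rw [lintegral_zero]

end

end WhiteToColoured

end Summit.CriticalPhenomena.CardyFormulaZ2.Theorems
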